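import Summits.BirchSwinnertonDyer.BirchSwinnertonDyer.Theorems.PrintX10bReadoutKSAnyClassNumber
import HarnessLib

/-!
# `controlGlueKS_anyClassNumber` — STUB B's KS-letter `Stmt.controlGlueKS` AT EVERY CLASS NUMBER (finding «hhK-IDLE», LEAD g11; K2c)

Cell `run/shared/lean/pub/bsd-print-x9/`, seat bsd-line-x10b-p1-w8 g9 («MINE K2» 02:47Z under LEAD g11's K-plan). Summits-side,
THEOREMS ONLY (no abbrev/def, no named fact, no instance, no `sorry`), ROUTE-INDEPENDENT (no `Theses` import),
`--supports stmt-BirchSwinnertonDyer-23055` (helper). HONEST FRAMING: nothing is closed; «beyond-print theorem»: no. BSD is not proved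
by any of this; no summit statement is proved by this seat.

WHAT. `controlGlueKS_anyClassNumber` = the KS-letter `Stmt.controlGlueKS` (`PrintX10bControlGlueOfClausesKS`, LEAD g10) with EXACTLY
the three idle binders `¬ W.HasCM`, `MastellaZerman2026.HasPadicScalarImage W p`, `p ∣ NumberField.classNumber K` deleted (leading
`Stmt.kummerStrictOnFrames`, `hirr`, `hirrK`, `hHp` kept in place and order), stated as a theorem and proved by the landed assembly
`controlGlueKS_of_clauses` verbatim, the two readout clauses now the any-class-number theorems `readoutSelmerKS_anyClassNumber` /
`readoutIndexKS_anyClassNumber` (K2b) instead of hypotheses: m-uniform compact inputs (p660971) + (B4) + (B5) ⟹ for `m ≫ 0` and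
every admissible Eisenstein datum, Howard's DVR conclusion on the Eisenstein setting yields a `SpecWitness` of the stabilised μ-part
(`HeegnerMuPartStabilized.nonempty_specWitness_of_dvrConclusion_of_readout`, p669215). With `kummerStrictOnFrames_holds` (p685979)
the leading binder is a theorem too; LEAD g11's K3 consumes this file for the class-number-free μ-letter and the ten-leaf census of
crux 23055.

References: [Howard2004HeegnerKolyvagin] Thm. 1.6.1, Prop. 2.2.8 and proof of Thm. 2.2.10 (𝔮 = T^m + p); [GreenbergLNM1716] Prop. 2.4,
§4 p. 98; [MastellaZerman2026] Thm. 2.40.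
-/

set_option linter.dupNamespace false
set_option autoImplicit false

noncomputable section

open scoped Classical Pointwise ContRepresentation TensorProduct NumberField

open Function NumberField IsDedekindDomain Field
open Literature Literature.NumberTheory.EllipticCurves WeierstrassCurve
open Literature.NumberTheory.GaloisCohomology Literature.NumberTheory.GaloisCohomology.Howard2004
open Literature.NumberTheory.GaloisRepresentations Literature.NumberTheory.GaloisRepresentations.DiscreteGaloisModule
open Literature.NumberTheory.EllipticCurves.GreenbergSelmer
open Summit.BirchSwinnertonDyer.BirchSwinnertonDyer.Theorems
open Literature.NumberTheory.EllipticCurves.ZpExtension (EisensteinLevel)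

namespace Summit.BirchSwinnertonDyer.BirchSwinnertonDyer.Theorems.HeegnerMuPartControlGlue

set_option maxHeartbeats 3200000 in
set_option synthInstance.maxHeartbeats 80000 in
/-- **STUB B's KS-letter at every class number** — `Stmt.controlGlueKS` minus the three idle binders, from the m-uniform compact
inputs and the two any-class-number readout clauses (K2b); proof verbatim `controlGlueKS_of_clauses`.
[cite: Howard2004HeegnerKolyvagin, Thm. 1.6.1, Prop. 2.2.8 and proof of Thm. 2.2.10 (𝔮 = T^m + p)]
[cite: GreenbergLNM1716, Prop. 2.4 and §4 p. 98] [cite: MastellaZerman2026, Thm. 2.40] -/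
theorem controlGlueKS_anyClassNumber :
    Stmt.kummerStrictOnFrames →
    ∀ (N : ℕ) [NeZero N] (W : WeierstrassCurve ℚ) [W.IsGloballyMinimal] (K : Type) [Field K] [NumberField K]
      (p : ℕ) [Fact p.Prime] (κ : ZpExtension K p) (γ : Field.absoluteGaloisGroup K)
      (jbar : AlgebraicClosure K →+* ℂ) (hyp : CastellaGrossiLeeSkinner2022.Thm413Hypotheses N W K p κ γ),
      W.HasIrreducibleModPGaloisRep p → (W.baseChange K).HasIrreducibleModPGaloisRep p →
      SatisfiesHeegnerHypothesis p K →
      ∀ (D : (W.baseChange K).LambdaAdicSelmerData κ γ)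
        (C : CastellaGrossiLeeSkinner2022.StabilizedHeegnerData N W K κ jbar)
        (X : (W.baseChange K).SelmerDualData κ γ) (z : D.S),
      (∀ (k : ℕ) (hk : C.depth < k), D.proj k z ∈ CastellaGrossiLeeSkinner2022.stabilizedClassLayer C k hk) →
      CastellaGrossiLeeSkinner2022.stabilizedHeegnerModule D C = Submodule.span (IwasawaAlgebra p) {z} →
      Module.Finite (IwasawaAlgebra p) D.S → Module.Finite (IwasawaAlgebra p) X.X →
      Module.IsTorsion (IwasawaAlgebra p) (D.S ⧸ CastellaGrossiLeeSkinner2022.stabilizedHeegnerModule D C) →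
      z ≠ 0 →
      ∃ c m₁ : ℕ, ∀ (m : ℕ) (hm : 1 ≤ m), m₁ ≤ m →
        haveI := hyp.isElliptic
        letI := IwasawaAlgebra.isDomain_quotient_X_pow_add_C p hm
        letI := IwasawaAlgebra.isDiscreteValuationRing_quotient_X_pow_add_C p hm
        haveI := IwasawaAlgebra.EisensteinCoeff.isLocalRing_succ p hm
        letI := IwasawaAlgebra.EisensteinCoeff.algebraOfSpecSucc p m
        haveI := W.isScalarTower_algebraOfSpecSucc (K := K) (p := p) (m := m)
        letI := W.residueModuleSucc (K := K) (p := p) hm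
        ∀ (S : Finset (IsDedekindDomain.HeightOneSpectrum (NumberField.RingOfIntegers K)))
          (hpS : ∀ v, ((p : ℕ) : NumberField.RingOfIntegers K) ∈ v.asIdeal → v ∈ S)
          (hbad : ∀ v, v ∉ S → ((p : ℕ) : NumberField.RingOfIntegers K) ∉ v.asIdeal →
            (W.baseChange K).HasGoodReductionAt v)
          (_hSN : ∀ v ∈ S, ((p : ℕ) : NumberField.RingOfIntegers K) ∈ v.asIdeal ∨
            ((N : ℕ) : NumberField.RingOfIntegers K) ∈ v.asIdeal)
          (_hSσ : ∀ (σ : K ≃ₐ[ℚ] K) (v : IsDedekindDomain.HeightOneSpectrum (NumberField.RingOfIntegers K)),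
            σ • v ∈ S → v ∈ S)
          (L : Set (IsDedekindDomain.HeightOneSpectrum (NumberField.RingOfIntegers K)))
          (hL : L ⊆ (W.eisensteinTower (κ.unitTwist (-1)) hm).degreeTwoPrimes p)
          (hLS : ∀ v ∈ L, v ∉ S) (jbar' : AlgebraicClosure K →+* ℂ) (cd : ConjugationDatum K)
          (Dd : ∀ k, DualityDatum p cd ((W.eisensteinTower (κ.unitTwist (-1)) hm).ρ k)
            (IwasawaAlgebra.EisensteinCoeff p m (k + 1)))
          (fs : ∀ (k : ℕ) (n : Finset (IsDedekindDomain.HeightOneSpectrum (NumberField.RingOfIntegers K)))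
            (v : IsDedekindDomain.HeightOneSpectrum (NumberField.RingOfIntegers K)),
            galoisCohomology ((W.eisensteinLevelQuot (κ.unitTwist (-1)) hm k n).toLocal (Sum.inr v)) 1 →+
              SingularQuotient (GaloisRep.toLocal v (W.eisensteinLevelQuot (κ.unitTwist (-1)) hm k n)) ⊗[ℤ]
                Gell v)
          (t : ∀ k, ((W.baseChange K).torsionGaloisModule ((p : ℤ) ^ (k + 1))).toContRepresentation →ⁱL
            ((W.baseChange K).torsionGaloisModule ((p : ℤ) ^ k)).toContRepresentation)
          (ht : ∀ k (P : geomTorsion (W.baseChange K) ((p : ℤ) ^ (k + 1))),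
            t k P = (W.baseChange K).geomTorsionReduce p k P)
          (I : ZpExtension.EisensteinH1Data (κ.unitTwist (-1))
            (fun k ↦ (W.baseChange K).torsionGaloisModule ((p : ℤ) ^ k)) t hm)
          (hy : (W.eisensteinDVRSetting (κ.unitTwist (-1)) hm S hpS hbad L hL hLS jbar' cd Dd fs).SatisfiesH),
          (W.eisensteinDVRSetting (κ.unitTwist (-1)) hm S hpS hbad L hL hLS jbar' cd Dd fs).Conclusion hy
              (fun k ↦ I.proj (k + 1) (D.toEisensteinH1Linear hm t ht I hyp.topGenerator hyp.noPTorsion z)) →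
            Nonempty (HeegnerMuPartStabilized.SpecWitness (IwasawaAlgebra p) D.S X.X
              (CastellaGrossiLeeSkinner2022.stabilizedHeegnerModule D C)
              (PowerSeries.X ^ m + PowerSeries.C (p : ℤ_[p]) : IwasawaAlgebra p) (p ^ c)) := by
  intro hKS N _ W _ K _ _ p _ κ γ jbar hyp hirr hirrK hHp D C X z hz hcyc hfinS hfinX htor hz0
  haveI := hyp.isElliptic
  haveI : Module.Finite (IwasawaAlgebra p) D.S := hfinS
  have htor' : Module.IsTorsion (IwasawaAlgebra p) (D.S ⧸ (IwasawaAlgebra p) ∙ z) := by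
    rw [← hcyc]; exact htor
  -- the m-UNIFORM constants: compact side (p660971), (B4), (B5)
  have hobt1 := PrintX10bCompactControl.exists_forall_compactInputs_eisensteinDVRSetting W K p κ γ D
    hyp.topGenerator hyp.noPTorsion z hz0 htor'
  obtain ⟨n₁, m₂, hA⟩ := hobt1
  have hobt2 := readoutSelmerKS_anyClassNumber hKS N W K p κ γ jbar hyp hirr hirrK hHp
  obtain ⟨m₄, hSelAll⟩ := hobt2
  have hobt3 := readoutIndexKS_anyClassNumber hKS N W K p κ γ jbar hyp hirr hirrK hHp
  obtain ⟨c₂, m₃, hIdxAll⟩ := hobt3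
  refine ⟨max (p ^ n₁) c₂, p ^ n₁ + 1 + m₂ + m₃ + m₄, fun m hm hmle ↦ ?_⟩
  letI := IwasawaAlgebra.isDomain_quotient_X_pow_add_C p hm
  letI := IwasawaAlgebra.isDiscreteValuationRing_quotient_X_pow_add_C p hm
  haveI := IwasawaAlgebra.EisensteinCoeff.isLocalRing_succ p hm
  letI := IwasawaAlgebra.EisensteinCoeff.algebraOfSpecSucc p m
  haveI := W.isScalarTower_algebraOfSpecSucc (K := K) (p := p) (m := m)
  letI := W.residueModuleSucc (K := K) (p := p) hm
  have hn₁m : p ^ n₁ < m := by omega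
  have hm₂m : m₂ ≤ m := by omega
  have hm₃m : m₃ ≤ m := by omega
  have hm₄m : m₄ ≤ m := by omega
  have hppos : 0 < p := (Fact.out : p.Prime).pos
  intro S hpS hbad hSN hSσ L hL hLS jbar' cd Dd fs t ht I hy hconc
  obtain rfl := PrintX10bCompactControl.eq_torsionGaloisModuleReduce t ht
  have ht' : ∀ k, Function.Surjective ((W.baseChange K).torsionGaloisModuleReduce p k) :=
    fun k ↦ (W.baseChange K).torsionGaloisModuleReduce_surjective p k
  -- the four bookkeeping proofs of the readout
  have hπ₀ : (W.eisensteinDVRSetting (κ.unitTwist (-1)) hm S hpS hbad L hL hLS jbar' cd Dd fs).π ∈ IsLocalRing.maximalIdeal (IwasawaAlgebra p ⧸ Ideal.span {(PowerSeries.X ^ m + PowerSeries.C (p : ℤ_[p]) : IwasawaAlgebra p)}) := by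
    rw [hy.unif]; exact Ideal.mem_span_singleton_self _
  have he₀ : ∀ k, (W.eisensteinDVRSetting (κ.unitTwist (-1)) hm S hpS hbad L hL hLS jbar' cd Dd fs).e k ≤ (W.eisensteinDVRSetting (κ.unitTwist (-1)) hm S hpS hbad L hL hLS jbar' cd Dd fs).e (k + 1) := fun k ↦ (hy.e_strictMono (Nat.lt_succ_self k)).le
  have hπX : (W.eisensteinDVRSetting (κ.unitTwist (-1)) hm S hpS hbad L hL hLS jbar' cd Dd fs).π = Ideal.Quotient.mk (Ideal.span {(PowerSeries.X ^ m + PowerSeries.C (p : ℤ_[p]) : IwasawaAlgebra p)}) PowerSeries.X := rfl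
  have hek : ∀ k, (W.eisensteinDVRSetting (κ.unitTwist (-1)) hm S hpS hbad L hL hLS jbar' cd Dd fs).e (k + 1) - (W.eisensteinDVRSetting (κ.unitTwist (-1)) hm S hpS hbad L hL hLS jbar' cd Dd fs).e k = m := by
    intro k
    rw [W.eisensteinDVRSetting_e, W.eisensteinDVRSetting_e, Nat.mul_succ, Nat.add_sub_cancel_left]
  -- (B4), (B5) at this `m` and datum
  have hSel := hSelAll m hm hm₄m S hpS hbad hSN hSσ L hL hLS jbar' cd Dd fs hy hπ₀ he₀ hπX hek
  have hobt4 := hIdxAll m hm hm₃m S hpS hbad hSN hSσ L hL hLS jbar' cd Dd fs hy hπ₀ he₀ hπX hek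
  obtain ⟨hfin, hidx⟩ := hobt4
  -- the control image lies in the pinned `H¹_{F_𝔮}` (ORD-ASCENT, p661609)
  have hf := fun s ↦ LambdaAdicSelmerData.toEisensteinH1Linear_mem_ordinarySelmer_of_thm413Hypotheses hyp D hm _ ht I
    S hpS hbad s
  -- the honest `S_m`-module `H := H¹_{F_𝔮}(K, T_𝔮)` (p658581)
  letI := (I.isTorsionBy_qm_submodule (I.selmerSubmodule ((κ.unitTwist (-1)).eisensteinSelmerStructure (fun k ↦ (W.baseChange K).torsionGaloisModule ((p : ℤ) ^ k)) (fun k ↦ (W.baseChange K).torsionGaloisModuleReduce p k) hm S (fun v _ ↦ (W.baseChange K).ordinaryFiltrationAt v (fun k ↦ (W.baseChange K).torsionGaloisModuleReduce p k) ht)) (fun k c x hx ↦ (κ.unitTwist (-1)).map_eisensteinTwistSMulHom_mem_selmerGroup (fun k ↦ (W.baseChange K).torsionGaloisModule ((p : ℤ) ^ k)) (fun k ↦ (W.baseChange K).torsionGaloisModuleReduce p k) hm S (fun v _ ↦ (W.baseChange K).ordinaryFiltrationAt v (fun k ↦ (W.baseChange K).torsionGaloisModuleReduce p k) ht) k c x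 hx))).module
  haveI := I.isScalarTower_qm_submodule (I.selmerSubmodule ((κ.unitTwist (-1)).eisensteinSelmerStructure (fun k ↦ (W.baseChange K).torsionGaloisModule ((p : ℤ) ^ k)) (fun k ↦ (W.baseChange K).torsionGaloisModuleReduce p k) hm S (fun v _ ↦ (W.baseChange K).ordinaryFiltrationAt v (fun k ↦ (W.baseChange K).torsionGaloisModuleReduce p k) ht)) (fun k c x hx ↦ (κ.unitTwist (-1)).map_eisensteinTwistSMulHom_mem_selmerGroup (fun k ↦ (W.baseChange K).torsionGaloisModule ((p : ℤ) ^ k)) (fun k ↦ (W.baseChange K).torsionGaloisModuleReduce p k) hm S (fun v _ ↦ (W.baseChange K).ordinaryFiltrationAt v (fun k ↦ (W.baseChange K).torsionGaloisModuleReduce p k) ht) k c x hx))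
  -- Howard's conclusion (i), for the compact turnkey (the conclusion itself stays available, unopened)
  have hconc' := hconc
  obtain ⟨x, hfree, -⟩ := hconc'
  have hobt5 := hA m hm hn₁m hm₂m S hpS hbad L hL hLS jbar' cd Dd fs _ ht I hf x hfree
  obtain ⟨⟨hcoker, hcoker_le⟩, hfz⟩ := hobt5
  -- the discrete turnkey (p669215)
  exact HeegnerMuPartStabilized.nonempty_specWitness_of_dvrConclusion_of_readout hm
    (CastellaGrossiLeeSkinner2022.stabilizedHeegnerModule D C) (W.baseChange K) hyp.topGenerator X
    (W.eisensteinDVRSetting (κ.unitTwist (-1)) hm S hpS hbad L hL hLS jbar' cd Dd fs) hy hπ₀ he₀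
    (fun k ↦ I.proj (k + 1) (D.toEisensteinH1Linear hm _ ht I hyp.topGenerator hyp.noPTorsion z))
    (PrintX10bCompactControl.proj_succ_mem_limitSelmer_eisensteinDVRSetting W K p κ hm S hpS hbad L hL hLS jbar' cd
      Dd fs _ ht I (hf z))
    (PrintX10bCompactControl.proj_succ_ne_zero I ht' hfz) hconc
    ((AddMonoidHom.pi (fun k ↦ I.proj (k + 1))).comp (I.selmerSubmodule ((κ.unitTwist (-1)).eisensteinSelmerStructure (fun k ↦ (W.baseChange K).torsionGaloisModule ((p : ℤ) ^ k)) (fun k ↦ (W.baseChange K).torsionGaloisModuleReduce p k) hm S (fun v _ ↦ (W.baseChange K).ordinaryFiltrationAt v (fun k ↦ (W.baseChange K).torsionGaloisModuleReduce p k) ht)) (fun k c x hx ↦ (κ.unitTwist (-1)).map_eisensteinTwistSMulHom_mem_selmerGroup (fun k ↦ (W.baseChange K).torsionGaloisModule ((p : ℤ) ^ k)) (fun k ↦ (W.baseChange K).torsionGaloisModuleReduce p k) hm S (fun v _ ↦ (W.baseChange K).ordinaryFiltrationAt v (fun k ↦ (W.baseChange K).torsionGaloisModuleReduce p k) ht)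 k c x hx)).subtype.toAddMonoidHom)
    ((I.injective_projSucc ht').comp Subtype.val_injective)
    (fun y ↦ I.mem_limitSelmer_succ_iff_mem_range ht' S _ y)
    (fun r y ↦ I.projSucc_smul ht' (I.selmerSubmodule ((κ.unitTwist (-1)).eisensteinSelmerStructure (fun k ↦ (W.baseChange K).torsionGaloisModule ((p : ℤ) ^ k)) (fun k ↦ (W.baseChange K).torsionGaloisModuleReduce p k) hm S (fun v _ ↦ (W.baseChange K).ordinaryFiltrationAt v (fun k ↦ (W.baseChange K).torsionGaloisModuleReduce p k) ht)) (fun k c x hx ↦ (κ.unitTwist (-1)).map_eisensteinTwistSMulHom_mem_selmerGroup (fun k ↦ (W.baseChange K).torsionGaloisModule ((p : ℤ) ^ k)) (fun k ↦ (W.baseChange K).torsionGaloisModuleReduce p k) hm S (fun v _ ↦ (W.baseChange K).ordinaryFiltrationAt v (fun k ↦ (W.baseChange K).torsionGaloisModuleReduce p k) ht) k c x hx)) r y)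
    ((D.toEisensteinH1Linear hm _ ht I hyp.topGenerator hyp.noPTorsion).codRestrict (I.selmerSubmodule ((κ.unitTwist (-1)).eisensteinSelmerStructure (fun k ↦ (W.baseChange K).torsionGaloisModule ((p : ℤ) ^ k)) (fun k ↦ (W.baseChange K).torsionGaloisModuleReduce p k) hm S (fun v _ ↦ (W.baseChange K).ordinaryFiltrationAt v (fun k ↦ (W.baseChange K).torsionGaloisModuleReduce p k) ht)) (fun k c x hx ↦ (κ.unitTwist (-1)).map_eisensteinTwistSMulHom_mem_selmerGroup (fun k ↦ (W.baseChange K).torsionGaloisModule ((p : ℤ) ^ k)) (fun k ↦ (W.baseChange K).torsionGaloisModuleReduce p k) hm S (fun v _ ↦ (W.baseChange K).ordinaryFiltrationAt v (fun k ↦ (W.baseChange K).torsionGaloisModuleReduce p k) ht) k c x hx)) hf)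
    ((D.toEisensteinH1Linear hm _ ht I hyp.topGenerator hyp.noPTorsion).codRestrict (I.selmerSubmodule ((κ.unitTwist (-1)).eisensteinSelmerStructure (fun k ↦ (W.baseChange K).torsionGaloisModule ((p : ℤ) ^ k)) (fun k ↦ (W.baseChange K).torsionGaloisModuleReduce p k) hm S (fun v _ ↦ (W.baseChange K).ordinaryFiltrationAt v (fun k ↦ (W.baseChange K).torsionGaloisModuleReduce p k) ht)) (fun k c x hx ↦ (κ.unitTwist (-1)).map_eisensteinTwistSMulHom_mem_selmerGroup (fun k ↦ (W.baseChange K).torsionGaloisModule ((p : ℤ) ^ k)) (fun k ↦ (W.baseChange K).torsionGaloisModuleReduce p k) hm S (fun v _ ↦ (W.baseChange K).ordinaryFiltrationAt v (fun k ↦ (W.baseChange K).torsionGaloisModuleReduce p k) ht) k c x hx)) hf z) rfl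
    (by rw [hcyc, Submodule.map_span, Set.image_singleton])
    (p ^ max (p ^ n₁) c₂) hcoker (hcoker_le.trans (Nat.pow_le_pow_right hppos (le_max_left _ _)))
    (W.eisensteinTowerReadout κ hm (W.eisensteinDVRSetting (κ.unitTwist (-1)) hm S hpS hbad L hL hLS jbar' cd Dd fs).π (W.eisensteinDVRSetting (κ.unitTwist (-1)) hm S hpS hbad L hL hLS jbar' cd Dd fs).e hy.killed hy.ker_red hπ₀ he₀ hπX hek)
    ((W.baseChange K).conjH1 p κ.kerSubgroup γ) (fun _ ↦ rfl)
    (fun j cj ↦ W.eisensteinTowerReadout_of_scalarMapH1_mk_X κ hm (W.eisensteinDVRSetting (κ.unitTwist (-1)) hm S hpS hbad L hL hLS jbar' cd Dd fs).π (W.eisensteinDVRSetting (κ.unitTwist (-1)) hm S hpS hbad L hL hLS jbar' cd Dd fs).e hy.killed hy.ker_red hπ₀ he₀ hπX hek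
      hyp.topGenerator _ (fun _ ↦ rfl) j cj)
    hSel hfin (hidx.trans (Nat.pow_le_pow_right hppos (le_max_right _ _)))

end Summit.BirchSwinnertonDyer.BirchSwinnertonDyer.Theorems.HeegnerMuPartControlGlue

end
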